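import Summits.ResolutionOfSingularities.ResolutionOfSingularities.Theorems.HilbertSamuelEliminationSigmaMaxModificationsCorridor3SigmaMenuGate
import Literature.AlgebraicGeometry.Resolution.NuEliminationBoundaryNEReachable
import Summits.ResolutionOfSingularities.ResolutionOfSingularities.Theorems.HilbertSamuelEliminationSigmaMaxModificationsCorridor3SigmaBoundaryBPermissible
import HarnessLib

/-!
# [OURS · L1 W4.2] σ-LAYER — `Corridor3SigmaMenuGateTame`: THE TAME GATE `γt` of the group gate of record (`GroupGate.byKind kind γe γt`, FILE 6
# p547638) — res-L1-w42-plan-1 RULING v3.14-42 part 2 (KE) «TAME GATE (R1‴) ADOPTED»: a centre `C` through a live TAME corner `g` passes iff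
# (i) IN-STRATUM AT `g` (the `S`-reading is constant along `C` near `g` AND every OLD member at `g` contains `C`) and (ii) `C` is NORMAL CROSSING at `g`
# with the NEW members — clause (ii) stated over res-lit-3's Literature predicate `IsNormalCrossingWithBoundaryAt` (CJS Def. 5.2; v2 pointwise, RULING
# v3.14-43 (KJ)); points pass; and the (KE′) AMENDMENT of the gate of record's shape: at TAME corners the member-face test is LIFTED
# (`GroupGate.ofRecordShapeKE`: exact ↦ face ∧ γe, tame ↦ γt, wild ↦ face)
# (crux chain w42 `SigmaMaxModifications` stmt-ResolutionOfSingularities-18506 / conjunct `SigmaMaxModificationsCorridor3` stmt-ResolutionOfSingularities-19249)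

OURS (cell res-hironaka, slot W4.2; typer res-L1-type-o1 g10); NOT statements of H. Hironaka's manuscript [Hironaka2017] nor of [CossartJannsenSaito2020];
AI-typed, weaker than expert review. Helper VOCABULARY `--supports stmt-ResolutionOfSingularities-19249 --as helper` (counted 0). Additive over `…SigmaMenuGate`
(`GroupGate`, `GroupGate.byKind`, `GroupGate.ofRecordShape`, `CentreGate.ofCorners`) and res-lit-3's `Literature…NuEliminationBoundaryNEReachable`
(`boundaryMember`, `boundarySupports`, `IsNormalCrossingWithBoundaryAt`, `IsBPermissible`). READINGS ARE PARAMETERS (as in FILE 6): the in-stratum reading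
`instr` (idea-2's (R1′): «`S = ord N` constant along `C` near `g`») and the OLD-MEMBER reading `old` (res-type-067's `Sigma.OldMembersAt`: the members at `g`
born before the start of `g`'s current `S`-stretch, transported by the (5.11) law, reset at an `H`-drop) plug in BY NAME; this file fixes the SHAPE.

## Design point (why clause (ii) is stated against the WHOLE current boundary)

CJS Def. 5.2 tests, at `g`, only the members THROUGH `g` that do NOT contain the centre (`𝓑(g) − 𝓑(g, D)`); the Literature predicate
`IsNormalCrossingWithBoundaryAt C E g` has exactly that filter built in (v2: `g ∈ boundarySupports E i ∧ ¬ stalkIdeal (boundaryMember E i) g ≤ stalkIdeal C g`).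
Under clause (i)(b) «every
OLD member at `g` contains `C`» the members it tests are therefore among the NEW members at `g` — so «n.c. with `N(g) = 𝓑(g) ∖ O(g)` at `g`» (the ruling's
(ii)) IS `IsNormalCrossingWithBoundaryAt C E g` for the full `E`, with no relabelled sub-boundary to build, and the gate's clause (ii) is LITERALLY the
point-`g` instance of the run invariant `IsBPermissible C E` (o-D3) (`GroupGate.tame_of_isBPermissible`: a `𝓑`-permissible centre through `g` passes (ii);
what the gate adds is (i)). «`B` contains `C`» is read `B ≤ C` (ideal sheaves), the ON-member condition of `…SigmaBoundaryCoincidence`; for the σ-layer's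
irreducible menu centres this global reading is the local one at `g` (`…SigmaBoundaryBPermissible` §3), and it implies the stalk-local reading
`stalkIdeal B g ≤ stalkIdeal C g` the predicate v2 uses (`stalkIdeal_mono`), so (i)(b)-members are indeed filtered out of (ii).

## Contents

* §1 `MemberReading` (a sub-boundary read at a point of a state), **`GroupGate.tame instr old`** + unfoldings, monotonicity, `tame_of_isBPermissible`,
  `GroupGate.inf` (conjunction of group gates — the socket for fork-branch L's extra clause (iii) «min-compatible», RULING v3.14-43 (KM), composed as
  `(GroupGate.tame instr old).inf minCompat`; branch G uses `GroupGate.tame` alone), the FILE-6 record-shape reading `GroupGate.ofRecordShape_tame_iff`.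
* §2 (KE′) **`GroupGate.ofRecordShapeKE face kind γe γt`** — the gate of record's shape v2: member-face test at EXACT and WILD corners only, the tame slot
  BYPASSES it (`_of_exact` ↔ face ∧ γe, `_of_tame` ↔ γt, `_of_wild` ↔ face; `ofRecordShape` ⇒ `ofRecordShapeKE`; with `γt := tame instr old`:
  `ofRecordShapeKE_tame_iff`), `CentreGate.ofCorners_tameKE_isNormalCrossingWithBoundaryAt`, and the G-thread form **`GroupGate.tameCanonical instr old canon`**
  (RULING v3.14-45 (KR)/(G3): + slot (iii) CANONICAL-ONLY as a third reading, instance over res-lit-3's F-91d `IsLocallyCanonicalAt` once drafted).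
* §3 POINTS PASS: `boundarySupports_eq_coe_support_boundaryMember`, `isNormalCrossingWithBoundaryAt_of_forall_le` (a centre contained in every member
  through `x` is n.c. at `x` iff regular at `x` — Def. 5.2 with `𝓑(x) = 𝓑(x, D)`), `le_menuCentre_closureSingleton_iff` (`B` contains the point centre iff
  `g ∈ V(B)`), **`isNormalCrossingWithBoundaryAt_point`** (the reduced point is n.c. with EVERY boundary, given its regularity as the hypothesis it is in
  067's `isMenuCentreAt_point`), **`GroupGate.tame_point`** (points pass, given the in-stratum reading passes points and old members at `g` pass through `g`).
* §4 (v2 append; TAME-FORK ADDENDUM B3, RULING v3.14-46 (KV)) `CentreGate.inf`, **`CentreGate.tamePrescribed tamePts canon := CentreGate.ofCorners tamePts canon`**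
  (slot (iii) ALONE at EVERY closed tame point of the centre), (iii) ⇒ (ii) (`tamePrescribed_isBPermissible` / `_isNormalCrossingWithBoundaryAt`) and the feed
  into the run invariant `isBPermissibleOnE_of_tamePrescribed`.
VACUITY: `GroupGate.tame` is a conjunction of three non-trivial clauses; §3 exhibits centres that pass (points) and the docstring of `GroupGate.tame` one
that fails (a curve tangent at `g` to a new member: Def. 5.2's regularity/codimension clause fails), so it is neither trivially true nor false as typed.
-/

noncomputable section

set_option linter.dupNamespace false -- mandated namespace of this single-conjunct summit

open CategoryTheory AlgebraicGeometry TopologicalSpace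
open Summit.ResolutionOfSingularities.ResolutionOfSingularities.Theorems.CampaignW42
open Literature.AlgebraicGeometry.Resolution Literature.RingTheory.HilbertSamuel

namespace Summit.ResolutionOfSingularities.ResolutionOfSingularities.Theorems.SigmaMaxModificationsCorridor3.Sigma

universe u

/-! ## §1. The tame gate -/

/-- [OURS · L1 W4.2] **A MEMBER READING AT A POINT**: at the state `(W, L, P, E)`, level `N`, value `ν`, and the point `g`, a SUB-BOUNDARY of `E` (instance:
res-type-067's `Sigma.OldMembersAt` — the OLD members at the corner `g`). NOT a statement of the manuscript. [folklore] -/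
abbrev MemberReading : Type (u + 1) :=
  ∀ (W : Scheme.{u}), IsLocallyNoetherian W → ℕ → (ℕ → ℕ) → Labelling W → Option (Pending W) → Boundary W → W → Boundary W

/-- [OURS · L1 W4.2] **THE TAME GATE `γt`** (RULING v3.14-42 part 2 (KE), (R1‴); replaces the role of CJS's «`𝓑`-permissible with respect to the boundary with
history `(𝓑, O)`» test (LNM 2270 Rem. 5.15 / Def. 5.4) at a live TAME corner of OUR σ-runs; NOT a statement of the manuscript). The centre `C` passes at the
corner `g` iff
* (i)(a) `instr … g C` — the IN-STRATUM reading: the tame currency `S` is constant along `C` near `g` (idea-2's (R1′); a parameter);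
* (i)(b) every OLD member at `g` CONTAINS the centre: `∀ B ∈ old … g, B ≤ C` (so `O` is constant along `C` near `g`, and `C` is `O`-permissible at `g` by the
  definitions);
* (ii) `C` is NORMAL CROSSING WITH THE CURRENT BOUNDARY at `g` (`IsNormalCrossingWithBoundaryAt C E g`, CJS Def. 5.2) — under (i)(b) the members this tests
  are exactly the NEW members at `g` not containing `C` (module docstring), i.e. the ruling's «n.c. at `g` with `N(g) = 𝓑(g) ∖ O(g)`».
FAILS e.g. for a regular curve `C ∋ g` tangent at `g` to a new member `B ∌ C` (`C ∩ B` is then not reduced of codimension `1` in `C` at `g`); PASSES for points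
(§3). [cite: CossartJannsenSaito2020, Def. 5.2, Def. 5.4, Rem. 5.15 (LNM 2270, pp. 67–73)] -/
def GroupGate.tame (instr : GroupGate.{u}) (old : MemberReading.{u}) : GroupGate.{u} :=
  fun W hW N ν L P E g C => instr W hW N ν L P E g C ∧ (∀ B ∈ old W hW N ν L P E g, B ≤ C) ∧ IsNormalCrossingWithBoundaryAt C E g

section Tame

variable {instr instr' : GroupGate.{u}} {old old' : MemberReading.{u}} {N : ℕ} {ν : ℕ → ℕ} {W : Scheme.{u}} {hW : IsLocallyNoetherian W}
  {L : Labelling W} {P : Option (Pending W)} {E : Boundary W} {g : W} {C : W.IdealSheafData}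

/-- Unfolding (`Iff.rfl`). [folklore] -/
theorem GroupGate.tame_iff :
    GroupGate.tame instr old W hW N ν L P E g C ↔
      instr W hW N ν L P E g C ∧ (∀ B ∈ old W hW N ν L P E g, B ≤ C) ∧ IsNormalCrossingWithBoundaryAt C E g :=
  Iff.rfl

/-- Clause (i)(a) of a passed centre. [folklore] -/
theorem GroupGate.tame_instr (h : GroupGate.tame instr old W hW N ν L P E g C) : instr W hW N ν L P E g C :=
  h.1

/-- Clause (i)(b) of a passed centre: every old member at `g` contains it. [folklore] -/
theorem GroupGate.tame_old_le (h : GroupGate.tame instr old W hW N ν L P E g C) {B : W.IdealSheafData} (hB : B ∈ old W hW N ν L P E g) : B ≤ C :=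
  h.2.1 B hB

/-- Clause (ii) of a passed centre: normal crossing with the current boundary at `g`. [cite: CossartJannsenSaito2020, Def. 5.2] -/
theorem GroupGate.tame_isNormalCrossingWithBoundaryAt (h : GroupGate.tame instr old W hW N ν L P E g C) : IsNormalCrossingWithBoundaryAt C E g :=
  h.2.2

/-- Monotone in the in-stratum reading, antitone in the old-member reading. [folklore] -/
theorem GroupGate.tame_mono (hi : ∀ W hW N ν L P E g C, instr W hW N ν L P E g C → instr' W hW N ν L P E g C)
    (ho : ∀ W hW N ν L P E g, old' W hW N ν L P E g ⊆ old W hW N ν L P E g) (h : GroupGate.tame instr old W hW N ν L P E g C) :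
    GroupGate.tame instr' old' W hW N ν L P E g C :=
  ⟨hi W hW N ν L P E g C h.1, fun B hB => h.2.1 B (ho W hW N ν L P E g hB), h.2.2⟩

/-- **A `𝓑`-PERMISSIBLE CENTRE THROUGH `g` PASSES CLAUSE (ii)** — so under the run invariant `IsBPermissibleOnE` (o-D3) the tame gate's content is clause (i).
[cite: CossartJannsenSaito2020, Def. 5.4] -/
theorem GroupGate.tame_of_isBPermissible (hB : IsBPermissible C E) (hg : g ∈ (C.support : Set W)) (hi : instr W hW N ν L P E g C)
    (hold : ∀ B ∈ old W hW N ν L P E g, B ≤ C) : GroupGate.tame instr old W hW N ν L P E g C :=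
  ⟨hi, hold, hB.2 g hg⟩

/-- **THE GATE OF RECORD AT A TAME CORNER with `γt := GroupGate.tame instr old`**: member-face test ∧ (i)(a) ∧ (i)(b) ∧ (ii). [folklore] -/
theorem GroupGate.ofRecordShape_tame_iff {face γe : GroupGate.{u}} {kind : CornerKindReading.{u}} (h : kind W hW N ν L P E g = .tame) :
    GroupGate.ofRecordShape face kind γe (GroupGate.tame instr old) W hW N ν L P E g C ↔
      face W hW N ν L P E g C ∧ instr W hW N ν L P E g C ∧ (∀ B ∈ old W hW N ν L P E g, B ≤ C) ∧ IsNormalCrossingWithBoundaryAt C E g := by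
  rw [GroupGate.ofRecordShape_of_tame h, GroupGate.tame_iff]

/-- **Along the centre gate of record**: a centre passing `CentreGate.ofCorners corners (ofRecordShape face kind γe (tame instr old))` is n.c. with the current
boundary at EVERY live tame corner on it. [cite: CossartJannsenSaito2020, Def. 5.2] -/
theorem CentreGate.ofCorners_tame_isNormalCrossingWithBoundaryAt {corners : CornerReading.{u}} {face γe : GroupGate.{u}} {kind : CornerKindReading.{u}}
    (h : CentreGate.ofCorners corners (GroupGate.ofRecordShape face kind γe (GroupGate.tame instr old)) W hW N ν L P E C)
    (hg : g ∈ corners W hW N ν L P E) (hgC : g ∈ (C.support : Set W)) (hk : kind W hW N ν L P E g = .tame) : IsNormalCrossingWithBoundaryAt C E g :=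
  (((GroupGate.ofRecordShape_tame_iff hk).mp (h g hg hgC)).2.2).2

/-- [OURS · L1 W4.2] **CONJUNCTION OF GROUP GATES** (socket for an extra clause, e.g. fork-branch L's (iii) «min-compatible»: `(tame instr old).inf minCompat`).
[folklore] -/
def GroupGate.inf (γ₁ γ₂ : GroupGate.{u}) : GroupGate.{u} :=
  fun W hW N ν L P E g C => γ₁ W hW N ν L P E g C ∧ γ₂ W hW N ν L P E g C

/-- Unfolding (`Iff.rfl`). [folklore] -/
@[simp] theorem GroupGate.inf_iff {γ₁ γ₂ : GroupGate.{u}} :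
    GroupGate.inf γ₁ γ₂ W hW N ν L P E g C ↔ γ₁ W hW N ν L P E g C ∧ γ₂ W hW N ν L P E g C :=
  Iff.rfl

/-- A centre passing `(tame instr old).inf γ` passes the tame gate (so all of §1/§3 applies under branch L's extra clause). [folklore] -/
theorem GroupGate.tame_of_inf {γ : GroupGate.{u}} (h : GroupGate.inf (GroupGate.tame instr old) γ W hW N ν L P E g C) :
    GroupGate.tame instr old W hW N ν L P E g C :=
  h.1

end Tame

/-! ## §2. (KE′) The gate of record's shape v2: the tame slot bypasses the member-face test -/

/-- [OURS · L1 W4.2] The proposition a kind assigns, all three slots free. [folklore] -/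
def CornerKind.gate₃ (pe pt pw : Prop) : CornerKind → Prop
  | .exact => pe
  | .tame => pt
  | .wild => pw

/-- [OURS · L1 W4.2] **THE GROUP GATE OF RECORD'S SHAPE, (KE′) AMENDMENT** (RULING v3.14-43 (KE′): «at TAME corners the member-face test is LIFTED for
gate-passing curves»): at an EXACT corner the member-face test AND `γe`; at a TAME corner `γt` ALONE (points, member faces and in-stratum E-adapted
irreducible top-locus curves all reach `γt`); at a WILD corner the member-face test only. FILE 6's `GroupGate.ofRecordShape` (face test in front of every
kind) implies it. NOT a statement of the manuscript. [folklore] -/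
def GroupGate.ofRecordShapeKE (face : GroupGate.{u}) (kind : CornerKindReading.{u}) (γe γt : GroupGate.{u}) : GroupGate.{u} :=
  fun W hW N ν L P E g C =>
    (kind W hW N ν L P E g).gate₃ (face W hW N ν L P E g C ∧ γe W hW N ν L P E g C) (γt W hW N ν L P E g C) (face W hW N ν L P E g C)

section KE

variable {face γe γt : GroupGate.{u}} {kind : CornerKindReading.{u}} {instr : GroupGate.{u}} {old : MemberReading.{u}} {N : ℕ} {ν : ℕ → ℕ}
  {W : Scheme.{u}} {hW : IsLocallyNoetherian W} {L : Labelling W} {P : Option (Pending W)} {E : Boundary W} {g : W} {C : W.IdealSheafData}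

/-- At an exact corner: face test and `γe`. [folklore] -/
theorem GroupGate.ofRecordShapeKE_of_exact (h : kind W hW N ν L P E g = .exact) :
    GroupGate.ofRecordShapeKE face kind γe γt W hW N ν L P E g C ↔ face W hW N ν L P E g C ∧ γe W hW N ν L P E g C := by
  simp [GroupGate.ofRecordShapeKE, CornerKind.gate₃, h]

/-- At a tame corner: `γt` alone (no member-face test). [folklore] -/
theorem GroupGate.ofRecordShapeKE_of_tame (h : kind W hW N ν L P E g = .tame) :
    GroupGate.ofRecordShapeKE face kind γe γt W hW N ν L P E g C ↔ γt W hW N ν L P E g C := by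
  simp [GroupGate.ofRecordShapeKE, CornerKind.gate₃, h]

/-- At a wild corner: the member-face test only. [folklore] -/
theorem GroupGate.ofRecordShapeKE_of_wild (h : kind W hW N ν L P E g = .wild) :
    GroupGate.ofRecordShapeKE face kind γe γt W hW N ν L P E g C ↔ face W hW N ν L P E g C := by
  simp [GroupGate.ofRecordShapeKE, CornerKind.gate₃, h]

/-- FILE 6's shape (face test in front of every kind) implies the (KE′) shape. [folklore] -/
theorem GroupGate.ofRecordShapeKE_of_ofRecordShape (h : GroupGate.ofRecordShape face kind γe γt W hW N ν L P E g C) :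
    GroupGate.ofRecordShapeKE face kind γe γt W hW N ν L P E g C := by
  obtain ⟨hf, hγ⟩ := h
  revert hγ
  simp only [GroupGate.byKind, GroupGate.ofRecordShapeKE]
  cases kind W hW N ν L P E g <;> simp [CornerKind.gate, CornerKind.gate₃, hf]

/-- **THE (KE′) GATE AT A TAME CORNER with `γt := GroupGate.tame instr old`**: (i)(a) ∧ (i)(b) ∧ (ii), nothing else. [folklore] -/
theorem GroupGate.ofRecordShapeKE_tame_iff (h : kind W hW N ν L P E g = .tame) :
    GroupGate.ofRecordShapeKE face kind γe (GroupGate.tame instr old) W hW N ν L P E g C ↔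
      instr W hW N ν L P E g C ∧ (∀ B ∈ old W hW N ν L P E g, B ≤ C) ∧ IsNormalCrossingWithBoundaryAt C E g := by
  rw [GroupGate.ofRecordShapeKE_of_tame h, GroupGate.tame_iff]

/-- **Along the (KE′) centre gate**: a passing centre is n.c. with the current boundary at every live tame corner on it. [cite: CossartJannsenSaito2020, Def. 5.2] -/
theorem CentreGate.ofCorners_tameKE_isNormalCrossingWithBoundaryAt {corners : CornerReading.{u}}
    (h : CentreGate.ofCorners corners (GroupGate.ofRecordShapeKE face kind γe (GroupGate.tame instr old)) W hW N ν L P E C)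
    (hg : g ∈ corners W hW N ν L P E) (hgC : g ∈ (C.support : Set W)) (hk : kind W hW N ν L P E g = .tame) : IsNormalCrossingWithBoundaryAt C E g :=
  (((GroupGate.ofRecordShapeKE_tame_iff hk).mp (h g hg hgC)).2).2

/-- [OURS · L1 W4.2] **THE TAME GATE OF RECORD, G-thread form** (RULING v3.14-45 (KR)/(KS) (G3)): clauses (i)(a), (i)(b), (ii) of `GroupGate.tame` AND
slot **(iii) CANONICAL-ONLY** as a third reading `canon … g C` («`C` is `g`'s executable (P2) centre, or the point `g` with `g` in phase (P1); centres
missing `g` are not asked» — instance over res-lit-3's `IsLocallyCanonicalAt` (F-91d, thread form) once drafted; a parameter here). `= (tame instr old).inf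
canon`. NOT a statement of the manuscript. [cite: CossartJannsenSaito2020, Proof of Thm. 6.28, Steps 5–7 (LNM 2270, pp. 94–96)] -/
def GroupGate.tameCanonical (instr : GroupGate.{u}) (old : MemberReading.{u}) (canon : GroupGate.{u}) : GroupGate.{u} :=
  GroupGate.inf (GroupGate.tame instr old) canon

/-- Unfolding. [folklore] -/
theorem GroupGate.tameCanonical_iff {canon : GroupGate.{u}} :
    GroupGate.tameCanonical instr old canon W hW N ν L P E g C ↔
      (instr W hW N ν L P E g C ∧ (∀ B ∈ old W hW N ν L P E g, B ≤ C) ∧ IsNormalCrossingWithBoundaryAt C E g) ∧ canon W hW N ν L P E g C :=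
  Iff.rfl

/-- A centre passing the G-thread gate passes the (KE) tame gate … [folklore] -/
theorem GroupGate.tameCanonical_tame {canon : GroupGate.{u}} (h : GroupGate.tameCanonical instr old canon W hW N ν L P E g C) :
    GroupGate.tame instr old W hW N ν L P E g C :=
  h.1

/-- … and slot (iii). [folklore] -/
theorem GroupGate.tameCanonical_canon {canon : GroupGate.{u}} (h : GroupGate.tameCanonical instr old canon W hW N ν L P E g C) :
    canon W hW N ν L P E g C :=
  h.2

/-- **THE (KE′) GATE AT A TAME CORNER with `γt := GroupGate.tameCanonical instr old canon`**: (i)(a) ∧ (i)(b) ∧ (ii) ∧ (iii). [folklore] -/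
theorem GroupGate.ofRecordShapeKE_tameCanonical_iff {canon : GroupGate.{u}} (h : kind W hW N ν L P E g = .tame) :
    GroupGate.ofRecordShapeKE face kind γe (GroupGate.tameCanonical instr old canon) W hW N ν L P E g C ↔
      (instr W hW N ν L P E g C ∧ (∀ B ∈ old W hW N ν L P E g, B ≤ C) ∧ IsNormalCrossingWithBoundaryAt C E g) ∧ canon W hW N ν L P E g C := by
  rw [GroupGate.ofRecordShapeKE_of_tame h, GroupGate.tameCanonical_iff]

end KE

/-! ## §3. Points pass -/

section Points

variable {W : Scheme.{u}}

/-- The support of the member with label `i` is the support of `boundaryMember 𝓑 i` (for labels beyond the length both are empty: `V(⊤) = ∅`). [folklore] -/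
theorem boundarySupports_eq_coe_support_boundaryMember (𝓑 : List W.IdealSheafData) (i : ℕ) :
    boundarySupports 𝓑 i = ((boundaryMember 𝓑 i).support : Set W) := by
  unfold boundarySupports boundaryMember
  cases 𝓑[i]? with
  | none => simp [Scheme.IdealSheafData.support_top]
  | some B => rfl

/-- **A centre contained, NEAR `x`, in EVERY member through `x` is normal crossing with the boundary at `x` as soon as it is regular at `x`** (Def. 5.2
with `𝓑(x) = 𝓑(x, D)`: only the empty family is tested; containment read stalk-locally, as the predicate v2 does — the global `boundaryMember 𝓑 i ≤ C`
implies it by `stalkIdeal_mono`). [cite: CossartJannsenSaito2020, Def. 5.2 (LNM 2270, p. 67)] -/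
theorem isNormalCrossingWithBoundaryAt_of_forall_le {C : W.IdealSheafData} {𝓑 : List W.IdealSheafData} {x : W}
    (hall : ∀ i, x ∈ boundarySupports 𝓑 i → stalkIdeal (boundaryMember 𝓑 i) x ≤ stalkIdeal C x)
    (hreg : IsRegularLocalRing ((W.presheaf.stalk x) ⧸ stalkIdeal C x)) :
    IsNormalCrossingWithBoundaryAt C 𝓑 x := by
  intro S hS
  have he : C ⊔ (∅ : Finset ℕ).sup (boundaryMember 𝓑) = C := by rw [Finset.sup_empty, sup_bot_eq]
  rcases S.eq_empty_or_nonempty with rfl | ⟨i, hi⟩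
  · rw [he, Finset.card_empty, Nat.cast_zero, add_zero]
    exact ⟨hreg, rfl⟩
  · exact absurd (hall i (hS i hi).1) (hS i hi).2

/-- **`B` CONTAINS THE POINT CENTRE iff the point lies on `V(B)`**: `B ≤ menuCentre (closure {g}) ↔ g ∈ V(B)`. [folklore] -/
theorem le_menuCentre_closureSingleton_iff (B : W.IdealSheafData) (g : W) :
    B ≤ menuCentre ⟨closure {g}, isClosed_closure⟩ ↔ g ∈ (B.support : Set W) := by
  rw [menuCentre, ← Scheme.IdealSheafData.le_support_iff_le_vanishingIdeal]
  change closure {g} ⊆ (B.support : Set W) ↔ _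
  rw [B.support.isClosed.closure_subset_iff, Set.singleton_subset_iff]

/-- **THE REDUCED POINT IS NORMAL CROSSING WITH EVERY BOUNDARY** (every member through `g` contains `{g}`), its regularity at `g` being the hypothesis it is in
res-type-067's `isMenuCentreAt_point`. [cite: CossartJannsenSaito2020, Def. 5.2 (LNM 2270, p. 67)] -/
theorem isNormalCrossingWithBoundaryAt_point (𝓑 : List W.IdealSheafData) {g : W}
    (hreg : IsRegularLocalRing ((W.presheaf.stalk g) ⧸ stalkIdeal (menuCentre ⟨closure {g}, isClosed_closure⟩) g)) :
    IsNormalCrossingWithBoundaryAt (menuCentre ⟨closure {g}, isClosed_closure⟩) 𝓑 g :=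
  isNormalCrossingWithBoundaryAt_of_forall_le
    (fun i hi => stalkIdeal_mono
      ((le_menuCentre_closureSingleton_iff _ g).mpr (by rwa [boundarySupports_eq_coe_support_boundaryMember] at hi)) g) hreg

variable {instr : GroupGate.{u}} {old : MemberReading.{u}} {N : ℕ} {ν : ℕ → ℕ} {hW : IsLocallyNoetherian W} {L : Labelling W} {P : Option (Pending W)}
  {E : Boundary W} {g : W}

/-- **POINTS PASS THE TAME GATE**: the reduced point centre at `g` passes, provided the in-stratum reading passes it (constancy along a point is empty), the
old members AT `g` pass THROUGH `g` (the reading's specification), and the reduced point is regular (hypothesis, as in `isMenuCentreAt_point`).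
[cite: CossartJannsenSaito2020, Def. 5.2, Rem. 5.15] -/
theorem GroupGate.tame_point (hi : instr W hW N ν L P E g (menuCentre ⟨closure {g}, isClosed_closure⟩))
    (hold : ∀ B ∈ old W hW N ν L P E g, g ∈ (B.support : Set W))
    (hreg : IsRegularLocalRing ((W.presheaf.stalk g) ⧸ stalkIdeal (menuCentre ⟨closure {g}, isClosed_closure⟩) g)) :
    GroupGate.tame instr old W hW N ν L P E g (menuCentre ⟨closure {g}, isClosed_closure⟩) :=
  ⟨hi, fun B hB => (le_menuCentre_closureSingleton_iff B g).mpr (hold B hB), isNormalCrossingWithBoundaryAt_point E hreg⟩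

/-- **POINTS PASS THE G-thread GATE when slot (iii) lets them** (phase (P1) at `g`, or `g`'s joint duty). [folklore] -/
theorem GroupGate.tameCanonical_point {canon : GroupGate.{u}} (hi : instr W hW N ν L P E g (menuCentre ⟨closure {g}, isClosed_closure⟩))
    (hold : ∀ B ∈ old W hW N ν L P E g, g ∈ (B.support : Set W))
    (hreg : IsRegularLocalRing ((W.presheaf.stalk g) ⧸ stalkIdeal (menuCentre ⟨closure {g}, isClosed_closure⟩) g))
    (hcanon : canon W hW N ν L P E g (menuCentre ⟨closure {g}, isClosed_closure⟩)) :
    GroupGate.tameCanonical instr old canon W hW N ν L P E g (menuCentre ⟨closure {g}, isClosed_closure⟩) :=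
  ⟨GroupGate.tame_point hi hold hreg, hcanon⟩

end Points


/-! ## §4. (appended 2026-08-27, same seat, v2) TAME-FORK ADDENDUM B3 (res-L1-w42-plan-1, 17:55Z) + RULING v3.14-46 (KV): slot (iii) ALONE,
evaluated at EVERY closed point of the centre lying in a tame stratum — `CentreGate.ofCorners tamePts canon` (FILE 6's shape over ANY point reading) —
and the conjunction of centre gates; (iii) ⇒ (ii) when the prescription reading carries `IsBPermissible` (lit-3's `ThreadState.IsPrescribedCentre` does,
F-91d); clause (i) stays a documented conjunct of `GroupGate.tameCanonical`. Corner KINDS of record (tri-2 v11.14 (KR-2), RULING -46 (KZ)): read from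
`((a_B)_B, S)` only — exact ⟺ `S = 0` (monomial IN THE MEMBERS), tame ⟺ `S ≥ 1` in the tame cell, wild = residual; `CornerKind` itself stays semantics-free. -/

section B3

variable {G₁ G₂ : CentreGate.{u}} {tamePts : CornerReading.{u}} {canon : GroupGate.{u}} {N : ℕ} {ν : ℕ → ℕ} {W : Scheme.{u}}
  {hW : IsLocallyNoetherian W} {L : Labelling W} {P : Option (Pending W)} {E : Boundary W} {C : W.IdealSheafData} {x : W}

/-- [OURS · L1 W4.2] **CONJUNCTION OF CENTRE GATES** (the gate of record, B3 form, is `(ofCorners liveCorners (ofRecordShapeKE face kind γe γt)).inf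
(ofCorners tamePts canon)`). NOT a statement of the manuscript. [folklore] -/
def CentreGate.inf (G₁ G₂ : CentreGate.{u}) : CentreGate.{u} :=
  fun W hW N ν L P E C => G₁ W hW N ν L P E C ∧ G₂ W hW N ν L P E C

/-- Unfolding (`Iff.rfl`). [folklore] -/
@[simp] theorem CentreGate.inf_iff : CentreGate.inf G₁ G₂ W hW N ν L P E C ↔ G₁ W hW N ν L P E C ∧ G₂ W hW N ν L P E C :=
  Iff.rfl

/-- A proposal gated by a conjunction passes both gates. [folklore] -/
theorem SiteProposal.gated_inf_passes {ρ : SiteProposal.{u}} {P' : Option (Pending (blowup C))}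
    (h : ρ.gated (CentreGate.inf G₁ G₂) W hW N ν L P E x C P') : G₁ W hW N ν L P E C ∧ G₂ W hW N ν L P E C :=
  SiteProposal.gated_passes h

/-- [OURS · L1 W4.2] **THE B3 TAME GATE — slot (iii) at EVERY closed tame point of the centre**: `C` passes iff at every point `x` of the reading `tamePts`
(instance: the closed points of value `(ν, S)` with `S ≥ 1` in the tame cell) lying on `V(C)`, the prescription reading `canon … x C` holds (instance: lit-3's
`ThreadState.IsPrescribedCentre` for `x`'s thread state on the surface germ, F-91d). This is FILE 6's `CentreGate.ofCorners` over the point reading `tamePts`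
— an `abbrev`, so every `ofCorners` lemma applies (`ofCorners_apply`, `_mono`, `_anti`, `_of_forall_not_mem`: centres missing every tame point pass). Replaces
the role of CJS's rule «the next centre of `S(X, ν̃)` through `x`» at OUR tame points; NOT a statement of the manuscript.
[cite: CossartJannsenSaito2020, Proof of Thm. 6.28, Steps 5–7 (LNM 2270, pp. 94–96)] -/
abbrev CentreGate.tamePrescribed (tamePts : CornerReading.{u}) (canon : GroupGate.{u}) : CentreGate.{u} :=
  CentreGate.ofCorners tamePts canon

/-- A passing centre is prescribed at every tame point on it. [folklore] -/
theorem CentreGate.tamePrescribed_apply (h : CentreGate.tamePrescribed tamePts canon W hW N ν L P E C) (hx : x ∈ tamePts W hW N ν L P E)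
    (hxC : x ∈ (C.support : Set W)) : canon W hW N ν L P E x C :=
  h x hx hxC

/-- **(iii) ⇒ (ii)**: when the prescription reading carries `𝓑`-permissibility for the current boundary (lit-3's `IsPrescribedCentre`'s first conjunct), a
centre passing the B3 gate through at least one tame point is `𝓑`-permissible, hence normal crossing with `E` at every point of `V(C)` — clause (ii) of
`GroupGate.tame` at every tame point is documentation. [cite: CossartJannsenSaito2020, Def. 5.4] -/
theorem CentreGate.tamePrescribed_isBPermissible (hcanon : ∀ W hW N ν L P E x C, canon W hW N ν L P E x C → IsBPermissible C E)
    (h : CentreGate.tamePrescribed tamePts canon W hW N ν L P E C) (hx : x ∈ tamePts W hW N ν L P E) (hxC : x ∈ (C.support : Set W)) :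
    IsBPermissible C E :=
  hcanon W hW N ν L P E x C (h x hx hxC)

/-- … in particular clause (ii) of the (KE) gate holds at every tame point on the centre. [cite: CossartJannsenSaito2020, Def. 5.2, Def. 5.4] -/
theorem CentreGate.tamePrescribed_isNormalCrossingWithBoundaryAt (hcanon : ∀ W hW N ν L P E x C, canon W hW N ν L P E x C → IsBPermissible C E)
    (h : CentreGate.tamePrescribed tamePts canon W hW N ν L P E C) (hx : x ∈ tamePts W hW N ν L P E) (hxC : x ∈ (C.support : Set W)) :
    IsNormalCrossingWithBoundaryAt C E x :=
  (CentreGate.tamePrescribed_isBPermissible hcanon h hx hxC).2 x hxC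

/-- **The B3 gate feeds the run invariant**: a strategy all of whose steps pass `tamePrescribed tamePts canon` through some tame point, with a
`𝓑`-permissibility-carrying `canon`, satisfies `IsBPermissibleOnE` on any scope (the other tiers' centres — exact faces, surface-phase cures/points — discharge
the invariant by their own `MenuClauseB`, `…SigmaBoundaryBPermissible`). [cite: CossartJannsenSaito2020, Def. 5.4] -/
theorem isBPermissibleOnE_of_tamePrescribed {𝒮 : StateScopeE.{u}} {σ : StrategyE.{u}}
    (hcanon : ∀ W hW N ν L P E x C, canon W hW N ν L P E x C → IsBPermissible C E)
    (hσ : ∀ (W : Scheme.{u}) (hW : IsLocallyNoetherian W) (L : Labelling W) (P : Option (Pending W)) (E : Boundary W), 𝒮 W hW L P E →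
      ∀ (C : W.IdealSheafData) (P' : Option (Pending (blowup C))), σ.step W hW N ν L P E C P' →
        CentreGate.tamePrescribed tamePts canon W hW N ν L P E C ∧ ∃ x ∈ tamePts W hW N ν L P E, x ∈ (C.support : Set W)) :
    σ.IsBPermissibleOnE 𝒮 N ν := by
  intro W hW L P E hS C P' hstep
  obtain ⟨hG, x, hx, hxC⟩ := hσ W hW L P E hS C P' hstep
  exact CentreGate.tamePrescribed_isBPermissible hcanon hG hx hxC

end B3

end Summit.ResolutionOfSingularities.ResolutionOfSingularities.Theorems.SigmaMaxModificationsCorridor3.Sigma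

end
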